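import Summits.CriticalPhenomena.CardyFormulaZ2.Theorems.CardyBoundaryCoulombGasRectilinearCardyClosureDefs
import Summits.CriticalPhenomena.CardyFormulaZ2.Theorems.CardyBoundaryCoulombGasRectilinearCardyTailNoAtom
import HarnessLib

/-!
# Stub D1 `stub_closureJunction` of line `excursion-kernel-covariance`, part 1: frame geometry of the
# closure discretisation at a flat junction
# (crux `RectilinearCardy`, stmt-CriticalPhenomena-5660, route `CardyBoundaryCoulombGas`)

Port of the frame bookkeeping of the landed MESH junction estimate
(`mem_discreteArc_of_frame`, `mem_discreteCrossing_of_sectorWalk`) to the CLOSURE discretisation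
`V_δ = closureFinset R δ` (vertices `v` with `δ v ∈ Ω̄`) and its boundary row (`boundaryRow`:
exactly one lattice neighbour outside `V_δ`), at a FLAT boundary point `b` (half-plane case
`m = 2` of the wedge; frame `u = (z - b)(-i)^a`, `Ω ∩ B(b, r) = {Im u > 0} ∩ B(b, r)`):

* `cjn_mem_closure_iff` — near `b`, `Ω̄ = {Im u ≥ 0}`;
* `cjn_infDist_le_of_frame` — the closest-arc inequality for a point just beside a boundary ray
  (verbatim the metric part of `mem_discreteArc_of_frame`);
* `cjn_two_of_flat` — flatness at `b` forces the half-plane case `m = 2` of the wedge;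
* `cjn_mem_boundaryRow_of_frame` — in lattice frame coordinates the boundary row near `b` is the
  first lattice line `⌈Im β⌉` inside `Ω̄`;
* `cjn_mem_openCrossing_of_sectorWalk` — **assembly**: an open standard-frame lattice walk in the
  lattice half-plane `{q ≥ ⌈Im β⌉}` from the row far right of `b` to the row far left of `b`,
  turned back by `σ_c⁻ᵃ`, is an open path of `V_δ` between boundary-row vertices attributed (closest-arc
  rule) to the boundary set carrying the start ray and to the one carrying the end ray.
-/

noncomputable section

open Set Filter Topology MeasureTheory Metric
open Literature.Probability.RandomPlanarGeometry
open Literature.Probability.Percolation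
open Literature.Probability.LatticeModels (Site zdGraph meshPoint meshDomain meshBoundary discreteArc
  meshVertices)

namespace Summit.CriticalPhenomena.CardyFormulaZ2.Cruxes.RectilinearCardy.ExcursionKernelCovariance

/-! ### The closed half-plane -/

/-- **Near a boundary point where the domain is the open half-plane `{Im u > 0}` of the frame
`u = (z - b)(-i)^a`, its closure is the closed half-plane `{Im u ≥ 0}`** (inside `B(b, r)`):
`{Im u < 0} ∩ B(b, r)` is an open set missing `Ω`, and a point with `Im u ≥ 0` is the limit of the
points `z + t i^(a+1)`, `t → 0⁺`, which have `Im u > 0`. [folklore] -/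
theorem cjn_mem_closure_iff {Ω : Set ℂ} {b : ℂ} {r : ℝ} {a : ℕ}
    (hΩ : ∀ z, dist z b < r → (z ∈ Ω ↔ 0 < ((z - b) * (-Complex.I) ^ a).im)) {z : ℂ}
    (hz : dist z b < r) : z ∈ closure Ω ↔ 0 ≤ ((z - b) * (-Complex.I) ^ a).im := by
  constructor
  · intro hzc
    by_contra hneg
    rw [not_le] at hneg
    have hopen : IsOpen {w : ℂ | dist w b < r ∧ ((w - b) * (-Complex.I) ^ a).im < 0} := by
      refine IsOpen.inter (isOpen_lt (continuous_id.dist continuous_const) continuous_const) ?_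
      exact isOpen_lt (Complex.continuous_im.comp ((continuous_id.sub continuous_const).mul
        continuous_const)) continuous_const
    rw [_root_.mem_closure_iff] at hzc
    obtain ⟨w, hw, hwΩ⟩ := hzc _ hopen ⟨hz, hneg⟩
    have := (hΩ w hw.1).1 hwΩ
    linarith [hw.2]
  · intro hnn
    rw [Metric.mem_closure_iff]
    intro ε hε
    set t : ℝ := min (ε / 2) ((r - dist z b) / 2) with ht
    have ht0 : 0 < t := lt_min (by linarith) (by linarith)
    have htε : t ≤ ε / 2 := min_le_left _ _
    have htr : t ≤ (r - dist z b) / 2 := min_le_right _ _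
    have hnorm : ‖(t : ℂ) * Complex.I ^ (a + 1)‖ = t := by
      rw [norm_mul, norm_pow, Complex.norm_I, one_pow, mul_one, Complex.norm_real, Real.norm_eq_abs,
        abs_of_pos ht0]
    refine ⟨z + (t : ℂ) * Complex.I ^ (a + 1), ?_, ?_⟩
    · have hd : dist (z + (t : ℂ) * Complex.I ^ (a + 1)) b < r := by
        calc dist (z + (t : ℂ) * Complex.I ^ (a + 1)) b
            ≤ dist (z + (t : ℂ) * Complex.I ^ (a + 1)) z + dist z b := dist_triangle _ _ _
          _ = t + dist z b := by rw [dist_eq_norm, add_sub_cancel_left, hnorm]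
          _ < r := by linarith
      rw [hΩ _ hd]
      have key : (z + (t : ℂ) * Complex.I ^ (a + 1) - b) * (-Complex.I) ^ a =
          (z - b) * (-Complex.I) ^ a + (t : ℂ) * Complex.I := by
        rw [pow_succ, show (z + (t : ℂ) * (Complex.I ^ a * Complex.I) - b) * (-Complex.I) ^ a =
          (z - b) * (-Complex.I) ^ a + (t : ℂ) * Complex.I * (Complex.I ^ a * (-Complex.I) ^ a) by ring,
          I_pow_mul_neg_I_pow, mul_one]
      have htI : ((t : ℂ) * Complex.I).im = t := by simp
      rw [key, Complex.add_im, htI]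
      linarith
    · rw [dist_eq_norm, sub_add_cancel_left, norm_neg, hnorm]
      linarith

/-! ### The closest-arc inequality beside a boundary ray -/

/-- **The closest-arc inequality for a point just beside a boundary ray** (the metric part of
`mem_discreteArc_of_frame`, verbatim). Frame `u = (z - b)(-i)^n`, `δ > 0`, `0 ≤ λ`; `P` contains
every point with `dist z b < r`, `u` real and `Re u > λ`; every point of `F ∖ P` within `r` of `b`
has `Re u ≤ 0` or `dist z b ≤ λ`. A point `p` whose frame coordinate has `Re u ≥ λ + 2δ`,
`|Im u| ≤ δ`, with `dist p b + 2δ ≤ r`, is at least as close to `P` as to `F ∖ P`: its foot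
`b + i^n Re u` is a point of `P` within `|Im u| ≤ δ`, everything in `F ∖ P` is at distance `≥ 2δ`.
[folklore] -/
theorem cjn_infDist_le_of_frame {F : Set ℂ} {δ : ℝ} (hδ : 0 < δ) {b : ℂ} {n : ℕ} {r lam : ℝ}
    (hlam : 0 ≤ lam) {P : Set ℂ} (hPne : (F \ P).Nonempty)
    (hPa : ∀ z, dist z b < r → ((z - b) * (-Complex.I) ^ n).im = 0 →
      lam < ((z - b) * (-Complex.I) ^ n).re → z ∈ P)
    (hPb : ∀ z ∈ F, z ∉ P → dist z b < r →
      ((z - b) * (-Complex.I) ^ n).re ≤ 0 ∨ dist z b ≤ lam)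
    {px : ℂ} (hre : lam + 2 * δ ≤ ((px - b) * (-Complex.I) ^ n).re)
    (him : |((px - b) * (-Complex.I) ^ n).im| ≤ δ) (hfit : dist px b + 2 * δ ≤ r) :
    infDist px P ≤ infDist px (F \ P) := by
  -- adapted from `mem_discreteArc_of_frame` (Theorems/…FrameArcs)
  set u := (px - b) * (-Complex.I) ^ n with hu
  have hnu : ‖u‖ = dist px b := norm_frame px b n
  -- the foot on the ray
  set f : ℂ := b + Complex.I ^ n * ((u.re : ℝ) : ℂ) with hf
  have huf : (f - b) * (-Complex.I) ^ n = ((u.re : ℝ) : ℂ) := by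
    rw [hf, add_sub_cancel_left, mul_comm (Complex.I ^ n), mul_assoc, ← mul_pow]
    simp
  have hure : 0 ≤ u.re := by linarith [hδ.le]
  have hfb : dist f b = u.re := by
    rw [← norm_frame f b n, huf, Complex.norm_real, Real.norm_eq_abs, abs_of_nonneg hure]
  have hfP : f ∈ P := by
    refine hPa f ?_ (by rw [huf]; simp) (by rw [huf]; simp; linarith)
    rw [hfb]
    have : u.re ≤ ‖u‖ := Complex.re_le_norm u
    linarith
  have hdist_f : dist px f = |u.im| := by
    have h1 : (px - f) * (-Complex.I) ^ n = u - ((u.re : ℝ) : ℂ) := by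
      rw [show px - f = (px - b) - (f - b) by ring, sub_mul, huf]
    have h2 : u - ((u.re : ℝ) : ℂ) = ((u.im : ℝ) : ℂ) * Complex.I :=
      Complex.ext (by simp) (by simp)
    rw [← norm_frame px f n, h1, h2, norm_mul, Complex.norm_I, mul_one, Complex.norm_real,
      Real.norm_eq_abs]
  have hup : infDist px P ≤ |u.im| := hdist_f ▸ infDist_le_dist_of_mem hfP
  refine hup.trans (him.trans ?_)
  -- everything off `P` in `F` is at distance `≥ 2δ ≥ δ`
  refine (le_infDist hPne).2 fun z hz => ?_
  obtain ⟨hzf, hzP⟩ := hz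
  by_cases hzr : dist z b < r
  · rcases hPb z hzf hzP hzr with h | h
    · -- behind `b`: the real parts differ by at least `Re u`
      have h1 : ‖(px - z) * (-Complex.I) ^ n‖ = dist px z := norm_frame px z n
      have h2 : (px - z) * (-Complex.I) ^ n = u - (z - b) * (-Complex.I) ^ n := by
        rw [hu, ← sub_mul]; ring
      have h3 : u.re - ((z - b) * (-Complex.I) ^ n).re ≤ ‖u - (z - b) * (-Complex.I) ^ n‖ := by
        have := Complex.re_le_norm (u - (z - b) * (-Complex.I) ^ n)
        rwa [Complex.sub_re] at this
      rw [← h1, h2]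
      linarith
    · -- close to `b`
      have h1 : dist px b ≤ dist px z + dist z b := dist_triangle _ _ _
      have h2 : u.re ≤ ‖u‖ := Complex.re_le_norm u
      linarith
  · rw [not_lt] at hzr
    have h1 : dist z b ≤ dist z px + dist px b := dist_triangle _ _ _
    rw [dist_comm z px] at h1
    linarith

/-! ### Flatness forces the half-plane case of the wedge -/

/-- **At a flat boundary point the wedge has two quadrants.** If the two boundary rays at `b` have
directions `i^a` and `i^(a+m)`, `m ∈ {1, 2, 3}`, and the points `b + ρ i^a`, `b + ρ i^(a+m)`
(`ρ > 0`) lie on a common horizontal or on a common vertical line through `b`, then `m = 2`.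
[folklore] -/
theorem cjn_two_of_flat {a m : ℕ} (hm : m = 1 ∨ m = 2 ∨ m = 3) {ρ : ℝ} (hρ : 0 < ρ)
    (h : (((ρ : ℂ) * Complex.I ^ a).im = 0 ∧ ((ρ : ℂ) * Complex.I ^ (a + m)).im = 0) ∨
      (((ρ : ℂ) * Complex.I ^ a).re = 0 ∧ ((ρ : ℂ) * Complex.I ^ (a + m)).re = 0)) : m = 2 := by
  have hρ0 : ρ ≠ 0 := hρ.ne'
  obtain ⟨k, hk, hka⟩ : ∃ k, k < 4 ∧ Complex.I ^ a = Complex.I ^ k :=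
    ⟨a % 4, Nat.mod_lt _ (by norm_num), Complex.I_pow_eq_pow_mod a⟩
  rw [pow_add, hka] at h
  rcases hm with rfl | rfl | rfl
  · exfalso
    interval_cases k <;> simp [pow_succ, hρ0] at h
  · rfl
  · exfalso
    interval_cases k <;> simp [pow_succ, hρ0] at h

/-! ### The boundary row in lattice frame coordinates -/

/-- **The boundary row in lattice frame coordinates.** Let `φ` be a lattice automorphism with
right inverse `ψ` (an iterate of the inverse quarter turn about `c`), and suppose that for the
lattice points `z` of the box `c + [-N-1, N+1]²` membership of `φ z` in `V_δ` reads `y₀ ≤ z₁ - c₁`.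
Then for `v` in the box `c + [-N, N]²` on the line `v₁ - c₁ = y₀`, `φ v` is a boundary-row vertex:
its neighbour `φ (v - e₁)` is outside `V_δ`, the three others are inside. [folklore] -/
theorem cjn_mem_boundaryRow_of_frame (R : ConformalRectangle) (δ : ℝ) {φ ψ : Site 2 → Site 2}
    (hφψ : ∀ u, φ (ψ u) = u) (hadj : ∀ x y, (zdGraph 2).Adj (φ x) (φ y) ↔ (zdGraph 2).Adj x y)
    {c : Site 2} {y₀ N : ℤ}
    (hmem : ∀ z : Site 2, |z 0 - c 0| ≤ N + 1 → |z 1 - c 1| ≤ N + 1 →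
      (φ z ∈ closureFinset R δ ↔ y₀ ≤ z 1 - c 1))
    {v : Site 2} (hv1 : v 1 - c 1 = y₀) (hv0 : |v 0 - c 0| ≤ N) (hvN : |v 1 - c 1| ≤ N) :
    φ v ∈ boundaryRow R δ := by
  classical
  have hv0' := abs_le.1 hv0
  have hvN' := abs_le.1 hvN
  have hvV : φ v ∈ closureFinset R δ :=
    (hmem v (abs_le.2 ⟨by omega, by omega⟩) (abs_le.2 ⟨by omega, by omega⟩)).2 hv1.ge
  refine (mem_boundaryRow_iff R).2 ⟨hvV, ?_⟩
  rw [Finset.card_eq_one]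
  refine ⟨φ (v - Pi.single 1 1), Finset.ext fun u => ?_⟩
  rw [Finset.mem_filter, SimpleGraph.mem_neighborFinset, Finset.mem_singleton]
  have hy0 : (v - Pi.single 1 1 : Site 2) 0 = v 0 := by simp
  have hy1 : (v - Pi.single 1 1 : Site 2) 1 = v 1 - 1 := by simp
  constructor
  · rintro ⟨hadj', huV⟩
    have hu : u = φ (ψ u) := (hφψ u).symm
    rw [hu] at hadj' huV ⊢
    rw [hadj] at hadj'
    have hcase := (zdGraph_two_adj_iff v (ψ u)).1 hadj'
    have hb : (ψ u) 0 ≤ v 0 + 1 ∧ v 0 ≤ (ψ u) 0 + 1 ∧ (ψ u) 1 ≤ v 1 + 1 ∧ v 1 ≤ (ψ u) 1 + 1 := by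
      rcases hcase with h | h | h | h <;> omega
    have hnot : ¬ y₀ ≤ (ψ u) 1 - c 1 := fun hle => huV ((hmem (ψ u)
      (abs_le.2 ⟨by omega, by omega⟩) (abs_le.2 ⟨by omega, by omega⟩)).2 hle)
    congr 1
    rw [Literature.Probability.LatticeModels.Site.eq_iff_two, hy0, hy1]
    rcases hcase with h | h | h | h <;> omega
  · rintro rfl
    refine ⟨(hadj _ _).2 ((zdGraph_two_adj_iff _ _).2
      (Or.inr (Or.inr (Or.inr ⟨by omega, by omega⟩)))), fun hV => ?_⟩
    have := (hmem (v - Pi.single 1 1) (by rw [hy0]; exact abs_le.2 ⟨by omega, by omega⟩)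
      (by rw [hy1]; exact abs_le.2 ⟨by omega, by omega⟩)).1 hV
    rw [hy1] at this
    omega

/-! ### Assembly: from a standard-frame half-plane walk to an open path of `V_δ` between the rows -/

/-- `(-i)^(a+2) = -(-i)^a`: real and imaginary parts of the frame turned by two quadrants. [folklore] -/
theorem cjn_frame_add_two (w : ℂ) (a : ℕ) :
    (w * (-Complex.I) ^ (a + 2)).re = -(w * (-Complex.I) ^ a).re ∧
      (w * (-Complex.I) ^ (a + 2)).im = -(w * (-Complex.I) ^ a).im := by
  rw [pow_add, ← mul_assoc]
  constructor <;> simp [pow_two]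

/-- **Assembly (closure discretisation, half-plane case).** `R` a conformal rectangle, `b ∈ ∂Ω`;
within `r` of `b` the frontier is the start ray `A₁` and the opposite ray `A₂` of the frame
`u = (z - b)(-i)^a` and the domain is the half-plane `{Im u > 0}`; `P₁ ⊇ A₁`, `P₂ ⊇ A₂` beyond
distance `λ` from `b`, with complements near `b` inside the other ray or within `λ` of `b`; `c` a
site with `dist (δc) b ≤ δ`, `l ≥ 3`, `λ ≤ (l - 3)δ`, `20 l δ ≤ r`. Then an open lattice walk of the
STANDARD frame (configuration `σ_c^a ω`) inside the lattice half-plane `{z₁ - c₁ ≥ ⌈Im β⌉}`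
(`β = (b - δc)(-i)^a / δ`) and the box `c + [-3l, 3l]²`, from the row `z₁ - c₁ = ⌈Im β⌉` at
`z₀ - c₀ ≥ l` to the same row at `z₀ - c₀ ≤ -l`, turned back by `σ_c⁻ᵃ`, is an open path of the
induced graph on `V_δ` (all its mesh points lie in `Ω̄ = {Im u ≥ 0}`, `cjn_mem_closure_iff`) whose
ends are boundary-row vertices (`cjn_mem_boundaryRow_of_frame`) attributed by the closest-arc rule
to `P₁` and to `P₂` (`cjn_infDist_le_of_frame`): `ω ∈ openCrossing V_δ (row of P₁) (row of P₂)`.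
No bulk hypothesis is needed: every lattice edge between vertices of `V_δ` is an edge of the
induced graph. [folklore] -/
theorem cjn_mem_openCrossing_of_sectorWalk (R : ConformalRectangle) {b : ℂ} {r : ℝ} {a : ℕ}
    {A₁ A₂ P₁ P₂ : Set ℂ}
    (hA₁ : ∀ z, dist z b < r → (z ∈ A₁ ↔ ((z - b) * (-Complex.I) ^ a).im = 0 ∧
      0 ≤ ((z - b) * (-Complex.I) ^ a).re))
    (hA₂ : ∀ z, dist z b < r → (z ∈ A₂ ↔ ((z - b) * (-Complex.I) ^ (a + 2)).im = 0 ∧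
      0 ≤ ((z - b) * (-Complex.I) ^ (a + 2)).re))
    (hΩ : ∀ z, dist z b < r → (z ∈ R.carrier ↔ 0 < ((z - b) * (-Complex.I) ^ a).im))
    {lam : ℝ} (hlam : 0 ≤ lam)
    (hP₁ne : (frontier R.carrier \ P₁).Nonempty) (hP₂ne : (frontier R.carrier \ P₂).Nonempty)
    (hP₁a : ∀ z ∈ A₁, lam < dist z b → z ∈ P₁)
    (hP₁b : ∀ z ∈ frontier R.carrier, z ∉ P₁ → dist z b < r → z ∈ A₂ ∨ dist z b ≤ lam)
    (hP₂a : ∀ z ∈ A₂, lam < dist z b → z ∈ P₂)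
    (hP₂b : ∀ z ∈ frontier R.carrier, z ∉ P₂ → dist z b < r → z ∈ A₁ ∨ dist z b ≤ lam)
    {δ : ℝ} (hδ : 0 < δ) {c : Site 2} (hcb : dist (meshPoint δ c) b ≤ δ) {l : ℕ} (hl : 3 ≤ l)
    (hlaml : lam ≤ ((l : ℝ) - 3) * δ) (hfit : 20 * (l : ℝ) * δ ≤ r)
    {ω : BondConfig (Site 2)} {vE vX : Site 2} (W₀ : (zdGraph 2).Walk vE vX)
    (hW₀e : ∀ e ∈ W₀.edges, e ∈ (BondConfig.relabel (sym2Equiv ((zdShiftIso c).comp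
      ((zdSignedPermIso (Equiv.swap (0 : Fin 2) 1) ![1, -1]).comp (zdShiftIso (-c)))).toEquiv))^[a] ω)
    (hW₀s : ∀ z ∈ W₀.support,
      ⌈(((b - meshPoint δ c) * (-Complex.I) ^ a) / (δ : ℂ)).im⌉ ≤ z 1 - c 1 ∧
      |z 0 - c 0| ≤ 3 * l ∧ |z 1 - c 1| ≤ 3 * l)
    (hvE : vE 1 - c 1 = ⌈(((b - meshPoint δ c) * (-Complex.I) ^ a) / (δ : ℂ)).im⌉ ∧
      (l : ℤ) ≤ vE 0 - c 0)
    (hvX : vX 1 - c 1 = ⌈(((b - meshPoint δ c) * (-Complex.I) ^ a) / (δ : ℂ)).im⌉ ∧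
      vX 0 - c 0 ≤ -(l : ℤ)) :
    ω ∈ openCrossing (↑(closureFinset R δ) : Set (Site 2))
      {v | v ∈ boundaryRow R δ ∧
        infDist (meshPoint δ v) P₁ ≤ infDist (meshPoint δ v) (frontier R.carrier \ P₁)}
      {v | v ∈ boundaryRow R δ ∧
        infDist (meshPoint δ v) P₂ ≤ infDist (meshPoint δ v) (frontier R.carrier \ P₂)} := by
  classical
  set σ := (zdShiftIso c).comp ((zdSignedPermIso (Equiv.swap (0 : Fin 2) 1) ![1, -1]).comp
    (zdShiftIso (-c))) with hσ
  set βδ : ℂ := (b - meshPoint δ c) * (-Complex.I) ^ a with hβδ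
  set β : ℂ := βδ / (δ : ℂ) with hβ
  set Ω := R.carrier with hΩdef
  have hl' : (3 : ℝ) ≤ l := by exact_mod_cast hl
  have hβδn : ‖βδ‖ ≤ δ := by
    rw [hβδ, norm_mul, norm_pow, norm_neg, Complex.norm_I, one_pow, mul_one, ← dist_eq_norm,
      dist_comm]; exact hcb
  have hβn : ‖β‖ ≤ 1 := by
    rw [hβ, norm_div, Complex.norm_real, Real.norm_eq_abs, abs_of_pos hδ, div_le_one hδ]
    exact hβδn
  have hβre := abs_le.1 ((Complex.abs_re_le_norm β).trans hβn)
  have hβim := abs_le.1 ((Complex.abs_im_le_norm β).trans hβn)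
  have hceil := Int.le_ceil β.im
  have hceil' := Int.ceil_lt_add_one β.im
  set U : Site 2 → ℂ := fun z => (δ : ℂ) * ((((z 0 - c 0 : ℤ)) : ℂ) + (((z 1 - c 1 : ℤ)) : ℂ) *
    Complex.I) - βδ with hU
  have hUframe : ∀ z : Site 2, (meshPoint δ ((σ.symm)^[a] z) - b) * (-Complex.I) ^ a = U z :=
    fun z => frame_meshPoint_iterate c δ b a z
  have hUri : ∀ z : Site 2, (U z).re = δ * (((z 0 - c 0 : ℤ) : ℝ) - β.re) ∧
      (U z).im = δ * (((z 1 - c 1 : ℤ) : ℝ) - β.im) := fun z => re_im_frame_lattice hδ βδ _ _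
  have hUdist : ∀ z : Site 2, dist (meshPoint δ ((σ.symm)^[a] z)) b = ‖U z‖ := fun z => by
    rw [← hUframe z, norm_frame]
  have hUnorm : ∀ z : Site 2, |z 0 - c 0| ≤ 3 * l + 1 → |z 1 - c 1| ≤ 3 * l + 1 →
      ‖U z‖ ≤ (6 * l + 3) * δ := fun z h0 h1 => norm_frame_le hδ h0 h1 hβδn
  have h7r : (6 * (l : ℝ) + 3) * δ + 2 * δ ≤ r := by nlinarith
  have hdz : ∀ z : Site 2, |z 0 - c 0| ≤ 3 * l + 1 → |z 1 - c 1| ≤ 3 * l + 1 →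
      dist (meshPoint δ ((σ.symm)^[a] z)) b < r := fun z h0 h1 => by
    rw [hUdist]; linarith [hUnorm z h0 h1]
  -- closure membership in the frame
  have hcl : ∀ z, dist z b < r → (z ∈ closure Ω ↔ 0 ≤ ((z - b) * (-Complex.I) ^ a).im) :=
    fun z hz => cjn_mem_closure_iff hΩ hz
  have hmem : ∀ z : Site 2, |z 0 - c 0| ≤ 3 * l + 1 → |z 1 - c 1| ≤ 3 * l + 1 →
      ((σ.symm)^[a] z ∈ closureFinset R δ ↔ ⌈β.im⌉ ≤ z 1 - c 1) := by
    intro z h0 h1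
    rw [mem_closureFinset_iff R hδ, hcl _ (hdz z h0 h1), hUframe, (hUri z).2, Int.ceil_le]
    constructor
    · intro h
      by_contra hlt
      rw [not_le] at hlt
      have : δ * (((z 1 - c 1 : ℤ) : ℝ) - β.im) < 0 := mul_neg_of_pos_of_neg hδ (by linarith)
      linarith
    · intro h
      exact mul_nonneg hδ.le (by linarith)
  -- the walk turned back is an open path of the induced graph on `V_δ`
  obtain ⟨W', hW'e, hW's⟩ := exists_walk_of_edges_mem_relabel_iterate σ a ω W₀ hW₀e
  have hW'V : ∀ x ∈ W'.support, x ∈ (↑(closureFinset R δ) : Set (Site 2)) := by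
    intro x hx
    obtain ⟨z, hz, rfl⟩ := (hW's x).1 hx
    have hb := hW₀s z hz
    have hb0 := abs_le.1 hb.2.1
    have hb1 := abs_le.1 hb.2.2
    exact Finset.mem_coe.2 ((hmem z (abs_le.2 ⟨by omega, by omega⟩)
      (abs_le.2 ⟨by omega, by omega⟩)).2 hb.1)
  have hconn : ω ∈ openConnIn (↑(closureFinset R δ) : Set (Site 2)) ((σ.symm)^[a] vE)
      ((σ.symm)^[a] vX) :=
    Literature.Probability.Percolation.mem_openConnIn_of_walk W' hW'V hW'e
  -- the two ends are boundary-row vertices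
  have hφψ : ∀ u : Site 2, (σ.symm)^[a] (σ^[a] u) = u :=
    Function.LeftInverse.iterate (fun x => σ.symm_apply_apply x) a
  have hadjσ : ∀ x y : Site 2, (zdGraph 2).Adj ((σ.symm)^[a] x) ((σ.symm)^[a] y) ↔
      (zdGraph 2).Adj x y := iterate_symm_adj_iff σ a
  have hvEb := hW₀s vE W₀.start_mem_support
  have hvXb := hW₀s vX W₀.end_mem_support
  have hrowE : (σ.symm)^[a] vE ∈ boundaryRow R δ :=
    cjn_mem_boundaryRow_of_frame R δ (φ := (σ.symm)^[a]) hφψ hadjσ (N := 3 * l) hmem hvE.1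
      hvEb.2.1 hvEb.2.2
  have hrowX : (σ.symm)^[a] vX ∈ boundaryRow R δ :=
    cjn_mem_boundaryRow_of_frame R δ (φ := (σ.symm)^[a]) hφψ hadjσ (N := 3 * l) hmem hvX.1
      hvXb.2.1 hvXb.2.2
  have hceilabs : |((⌈β.im⌉ : ℤ) : ℝ) - β.im| ≤ 1 := abs_le.2 ⟨by linarith, by linarith⟩
  -- the start end is attributed to `P₁`
  have hE_attr : infDist (meshPoint δ ((σ.symm)^[a] vE)) P₁ ≤
      infDist (meshPoint δ ((σ.symm)^[a] vE)) (frontier Ω \ P₁) := by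
    refine cjn_infDist_le_of_frame (b := b) (n := a) (r := r) hδ hlam hP₁ne ?_ ?_ ?_ ?_ ?_
    · intro z hzr hzim hzre
      exact hP₁a z ((hA₁ z hzr).2 ⟨hzim, by linarith⟩)
        (by rw [← norm_frame z b a]; exact hzre.trans_le (Complex.re_le_norm _))
    · intro z hzf hzP hzr
      rcases hP₁b z hzf hzP hzr with hz2 | hzl
      · left
        obtain ⟨-, hre2⟩ := (hA₂ z hzr).1 hz2
        rw [(cjn_frame_add_two _ a).1] at hre2
        linarith
      · exact Or.inr hzl
    · rw [hUframe, (hUri vE).1]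
      have : ((l : ℤ) : ℝ) ≤ ((vE 0 - c 0 : ℤ) : ℝ) := by exact_mod_cast hvE.2
      push_cast at this ⊢
      nlinarith [mul_le_mul_of_nonneg_left this hδ.le, mul_le_mul_of_nonneg_left hβre.2 hδ.le]
    · rw [hUframe, (hUri vE).2, hvE.1, abs_mul, abs_of_pos hδ]
      have := mul_le_mul_of_nonneg_left hceilabs hδ.le
      linarith
    · rw [hUdist]; linarith [hUnorm vE (by omega) (by omega)]
  -- the end end is attributed to `P₂`
  have hX_attr : infDist (meshPoint δ ((σ.symm)^[a] vX)) P₂ ≤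
      infDist (meshPoint δ ((σ.symm)^[a] vX)) (frontier Ω \ P₂) := by
    refine cjn_infDist_le_of_frame (b := b) (n := a + 2) (r := r) hδ hlam hP₂ne ?_ ?_ ?_ ?_ ?_
    · intro z hzr hzim hzre
      exact hP₂a z ((hA₂ z hzr).2 ⟨hzim, by linarith⟩)
        (by rw [← norm_frame z b (a + 2)]; exact hzre.trans_le (Complex.re_le_norm _))
    · intro z hzf hzP hzr
      rcases hP₂b z hzf hzP hzr with hz1 | hzl
      · left
        obtain ⟨-, hre1⟩ := (hA₁ z hzr).1 hz1
        rw [(cjn_frame_add_two _ a).1]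
        linarith
      · exact Or.inr hzl
    · rw [(cjn_frame_add_two _ a).1, hUframe, (hUri vX).1]
      have : ((vX 0 - c 0 : ℤ) : ℝ) ≤ -((l : ℤ) : ℝ) := by exact_mod_cast hvX.2
      push_cast at this ⊢
      nlinarith [mul_le_mul_of_nonneg_left this hδ.le, mul_le_mul_of_nonneg_left hβre.1 hδ.le]
    · rw [(cjn_frame_add_two _ a).2, abs_neg, hUframe, (hUri vX).2, hvX.1, abs_mul, abs_of_pos hδ]
      have := mul_le_mul_of_nonneg_left hceilabs hδ.le
      linarith
    · rw [hUdist]; linarith [hUnorm vX (by omega) (by omega)]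
  exact ⟨_, ⟨hrowE, hE_attr⟩, _, ⟨hrowX, hX_attr⟩, hconn⟩

end Summit.CriticalPhenomena.CardyFormulaZ2.Cruxes.RectilinearCardy.ExcursionKernelCovariance

end
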